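import Summits.ResolutionOfSingularities.ResolutionOfSingularities.Theorems.EquisingularLiftEquisingularLiftNatFanGameWalls
import HarnessLib

/-!
# [OURS · L1 W4.5(b) · EL♮(3) · D-0157 DOOR 1, WIDTH row iso-w4] FAN-GAME WINNABILITY — brick 2c′: PHASE 2 keeps what it has won

res-L1-w45b-iso-w4 g0 (prover, width seat; desk WIDTH TABLE D1/D1′; referee crit-2). `--supports stmt-ResolutionOfSingularities-20148 --as helper`.
Sorry-free, fact-free. OURS; counted 0; AI kernel work, weaker than expert review; NOT a statement of any manuscript; nothing of [Hironaka2017] is used;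
resolution of singularities in characteristic `p` is NOT proved here or anywhere in this chain.
Blueprint: `L/res-L1-w45b-iso-w4/FANGAME-MEMO.md` §6 («NODES FIRST, THEN WALLS»).

## What is proved

* `FanGame.coeff_eq_zero_of_sum_smul_eq_zero` — the rays of a smooth cone are linearly independent (`Matrix.vecMul_injective_of_isUnit`).
* ★ `FanGame.coeff_eq_zero_of_wallPoint` (LEMMA A) — in a cone without W-crossing pair (position separated, smooth, node directions rays), a wall point
  (`ℓ = 0`, `m` minimal) represented over the cone has zero coefficient on every ray off the wall hyperplane (TAKEOVER towards the crossing point of an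
  edge; the catch-up point would be a node inside the cone; FAN EXCLUSION; linear independence).
* ★ `FanGame.not_wcross_sum` (LEMMA B), `noWCross_star`, ★★ `noWCross_of_reach` — `NoWCross V m m'` SURVIVES every later E1-legal star: the wall of
  `(m, m')`, once a union of faces, stays one.
-/

set_option linter.dupNamespace false

open Matrix

namespace Summit.ResolutionOfSingularities.ResolutionOfSingularities.Cruxes.EquisingularLiftNat.Sections

namespace FanGame

variable {n : ℕ}

/-! ### Keeping `NoWCross` under later stars -/

/-- **Linear independence of the rays of a smooth cone**: an integer relation among them is trivial (`Matrix.vecMul_injective_of_isUnit`). -/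
theorem coeff_eq_zero_of_sum_smul_eq_zero {σ : Finset (Ray n)} (hσ : ND.IsSmoothCone σ) {e : Ray n → ℤ}
    (h : ∑ ρ ∈ σ, e ρ • ρ = 0) : ∀ ρ ∈ σ, e ρ = 0 := by
  classical
  obtain ⟨B, hB, hdet⟩ := hσ
  have hA : IsUnit (ND.zMat B) := (Matrix.isUnit_iff_isUnit_det _).2 hdet
  have hinj := ND.rayOf_injective_of_isUnit B hdet
  -- the relation is `c ᵥ* zMat B = 0` for `c i := e (rayOf (B i))`
  have hvec : Matrix.vecMul (fun i => e (ND.rayOf (B i))) (ND.zMat B) = 0 := by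
    have h1 : Matrix.vecMul (fun i => e (ND.rayOf (B i))) (ND.zMat B) = ∑ i, e (ND.rayOf (B i)) • ND.rayOf (B i) := by
      ext l
      simp only [Matrix.vecMul, dotProduct, Finset.sum_apply, Pi.smul_apply, smul_eq_mul, ND.zMat, Matrix.of_apply, ND.rayOf]
    rw [h1]
    have h2 : ∑ i, e (ND.rayOf (B i)) • ND.rayOf (B i) = ∑ ρ ∈ Finset.univ.image (fun i => ND.rayOf (B i)), e ρ • ρ := by
      rw [Finset.sum_image (fun i _ j _ hij => hinj hij)]
    rw [h2, ← hB, h]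
  have hc : (fun i => e (ND.rayOf (B i))) = 0 :=
    Matrix.vecMul_injective_of_isUnit hA (by show Matrix.vecMul _ _ = Matrix.vecMul _ _; rw [hvec, Matrix.zero_vecMul])
  intro ρ hρ
  rw [hB] at hρ
  obtain ⟨i, -, rfl⟩ := Finset.mem_image.1 hρ
  exact congr_fun hc i

/-- `lin` of a combination of rays. -/
theorem lin_sum_smul (z : Fin n → ℤ) (σ : Finset (Ray n)) (c : Ray n → ℕ) :
    lin z (∑ ρ ∈ σ, (c ρ : ℤ) • ρ) = ∑ ρ ∈ σ, (c ρ : ℤ) * lin z ρ := by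
  classical
  induction σ using Finset.induction_on with
  | empty => simp [lin]
  | insert a s ha ih => rw [Finset.sum_insert ha, Finset.sum_insert ha, lin_add, lin_smul, ih]

/-- Representations add (with non-negative integer weights). -/
theorem rep_smul_add {σ : Finset (Ray n)} {c d : Ray n → ℕ} {y b : Ray n} (hy : Rep σ c y) (hb : Rep σ d b) {A B : ℤ}
    (hA : 0 ≤ A) (hB : 0 ≤ B) : Rep σ (fun ρ => B.toNat * c ρ + A.toNat * d ρ) (B • y + A • b) := by
  unfold Rep at hy hb ⊢
  rw [← hy, ← hb, Finset.smul_sum, Finset.smul_sum, ← Finset.sum_add_distrib]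
  refine Finset.sum_congr rfl (fun ρ _ => ?_)
  rw [smul_smul, smul_smul, ← add_smul]
  congr 1
  push_cast
  rw [Int.toNat_of_nonneg hA, Int.toNat_of_nonneg hB, mul_comm B, mul_comm A]

/-- The crossing point of two distinct rays of `σ` is represented over `σ`. -/
theorem rep_xPt {σ : Finset (Ray n)} {m m' : Fin n → ℕ} {u v : Ray n} (hu : u ∈ σ) (hv : v ∈ σ) (huv : u ≠ v)
    (hlu : 0 < lin (zOf m m') u) (hlv : lin (zOf m m') v < 0) :
    Rep σ (fun ρ => if ρ = v then (lin (zOf m m') u).toNat else if ρ = u then (-lin (zOf m m') v).toNat else 0) (xPt m m' u v) := by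
  classical
  unfold Rep xPt
  have hsplit : ∀ ρ ∈ σ, (((if ρ = v then (lin (zOf m m') u).toNat else if ρ = u then (-lin (zOf m m') v).toNat else 0 : ℕ) : ℤ)) • ρ =
      (if ρ = v then (lin (zOf m m') u) • v else 0) + (if ρ = u then (-lin (zOf m m') v) • u else 0) := by
    intro ρ _
    by_cases h1 : ρ = v
    · subst h1; rw [if_pos rfl, if_pos rfl, if_neg (Ne.symm huv), add_zero, Int.toNat_of_nonneg hlu.le]
    · rw [if_neg h1, if_neg h1, zero_add]
      by_cases h2 : ρ = u
      · subst h2; rw [if_pos rfl, if_pos rfl, Int.toNat_of_nonneg (by linarith)]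
      · rw [if_neg h2, if_neg h2]; simp
  rw [Finset.sum_congr rfl hsplit, Finset.sum_add_distrib, Finset.sum_ite_eq' σ v, if_pos hv, Finset.sum_ite_eq' σ u, if_pos hu]

/-- The independence step shared by the TAKEOVER applications: if `m ≠ m'` tie at `b` and the competitor `m₁` is strictly better than `m` at `b`,
then `m' − m` and `m₁ − m` are independent. -/
theorem indep_of_takeover {m m' m₁ : Fin n → ℕ} (hmm' : m ≠ m') {b : Ray n} (htie : pair b m' = pair b m) {B : ℤ} (hB : 0 < B)
    (hBeq : pair b m₁ + B = pair b m) : Indep (ND.rayOf m' - ND.rayOf m) (ND.rayOf m₁ - ND.rayOf m) := by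
  intro a c hab
  have h1 : a * (pair b m' - pair b m) = c * (pair b m₁ - pair b m) := by
    have := congr_arg (fun d => b ⬝ᵥ d) hab
    simp only [dotProduct_smul, dotProduct_sub, ← pair_eq_dotProduct, smul_eq_mul] at this
    exact this
  rw [htie, sub_self, mul_zero, show pair b m₁ - pair b m = -B by linarith] at h1
  have hc : c = 0 := by
    have : c * B = 0 := by linarith
    rcases mul_eq_zero.1 this with h | h
    · exact h
    · exact absurd h hB.ne'
  subst hc
  rw [zero_smul] at hab
  rcases smul_eq_zero.1 hab with h | h
  · exact ⟨h, rfl⟩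
  · exfalso; apply hmm'
    have : ND.rayOf m' = ND.rayOf m := sub_eq_zero.1 h
    funext i; have := congr_fun this i; simpa [ND.rayOf] using this.symm

/-- **LEMMA A.**  In a cone `σ` without W-crossing pair (position separated, smooth, node directions rays), a wall point `y` (`ℓ y = 0`, `m` minimal at
`y`) represented over `σ` has ZERO coefficient on every ray `v` with `ℓ v < 0`. [OURS · L1 W4.5b · brick 2c] -/
theorem coeff_eq_zero_of_wallPoint {V : Finset (Fin 3 → ℕ)} {F : Finset (Finset (Ray 3))} (hSep : Separated F) (hN : NodesResolved V F)
    {σ : Finset (Ray 3)} (hσF : σ ∈ F) (hσ : ND.IsSmoothCone σ) {m m' : Fin 3 → ℕ} (hm : m ∈ V) (hm' : m' ∈ V) (hmm' : m ≠ m')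
    (hno : ∀ u ∈ σ, ∀ v ∈ σ, ¬ WCross V m m' u v) {c : Ray 3 → ℕ} {y : Ray 3} (hy : Rep σ c y) (hly : lin (zOf m m') y = 0)
    (hmin : ∀ m'' ∈ V, pair y m ≤ pair y m'') {v : Ray 3} (hv : v ∈ σ) (hlv : lin (zOf m m') v < 0) : c v = 0 := by
  classical
  by_contra hcv
  have hcv' : 0 < c v := Nat.pos_of_ne_zero hcv
  -- a ray `ρ₀` with positive coefficient and `ℓ ρ₀ > 0`
  obtain ⟨ρ₀, hρ₀, hc₀, hl₀⟩ : ∃ ρ₀ ∈ σ, 0 < c ρ₀ ∧ 0 < lin (zOf m m') ρ₀ := by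
    by_contra hno'
    push Not at hno'
    have hsum : lin (zOf m m') y = ∑ ρ ∈ σ, (c ρ : ℤ) * lin (zOf m m') ρ := by
      rw [← hy, lin_sum_smul]
    have hle : ∑ ρ ∈ σ, (c ρ : ℤ) * lin (zOf m m') ρ ≤ (c v : ℤ) * lin (zOf m m') v := by
      rw [← Finset.add_sum_erase σ _ hv]
      have : ∑ ρ ∈ σ.erase v, (c ρ : ℤ) * lin (zOf m m') ρ ≤ 0 := Finset.sum_nonpos (fun ρ hρ => by
        rcases Nat.eq_zero_or_pos (c ρ) with h | h
        · rw [h]; simp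
        · exact mul_nonpos_of_nonneg_of_nonpos (by positivity) (hno' ρ (Finset.mem_of_mem_erase hρ) h))
      linarith
    have hneg : (c v : ℤ) * lin (zOf m m') v < 0 := mul_neg_of_pos_of_neg (by exact_mod_cast hcv') hlv
    linarith
  have hρ₀v : ρ₀ ≠ v := by rintro rfl; linarith
  -- `m` is not minimal at the crossing point `b := x_{ρ₀ v}` (no W-crossing pair)
  have hb : ∃ m'' ∈ V, pair (xPt m m' ρ₀ v) m'' < pair (xPt m m' ρ₀ v) m := by
    by_contra h; push Not at h
    exact hno ρ₀ hρ₀ v hv ⟨hl₀, hlv, h⟩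
  -- TAKEOVER from `y` to `b`
  obtain ⟨m₁, hm₁, A, B, hA, hB, -, hBeq, hminy, htie⟩ := takeover V y (xPt m m' ρ₀ v) hmin hb
  set y' := B • y + A • xPt m m' ρ₀ v with hy'
  have hly' : lin (zOf m m') y' = 0 := by rw [hy', lin_add, lin_smul, lin_smul, hly, lin_xPt]; ring
  have htie' : pair y' m' = pair y' m := by rw [lin_zOf] at hly'; linarith
  have htieb : pair (xPt m m' ρ₀ v) m' = pair (xPt m m' ρ₀ v) m := by
    have := lin_xPt m m' ρ₀ v; rw [lin_zOf] at this; linarith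
  have hind := indep_of_takeover hmm' htieb hB hBeq
  have hnode : IsNodePoint V y' := ⟨m, hm, m', hm', m₁, hm₁, hminy, htie', htie, hind⟩
  -- representation of `y'` over `σ`, with positive coefficient on `v`
  have hrep' := rep_smul_add hy (rep_xPt (m := m) (m' := m') hρ₀ hv hρ₀v hl₀ hlv) hA hB.le
  rw [← hy'] at hrep'
  have hy'0 : ∀ i, 0 ≤ y' i := fun i => by
    have e := congr_fun hrep' i
    simp only [Finset.sum_apply, Pi.smul_apply, smul_eq_mul] at e
    rw [← e]
    exact Finset.sum_nonneg (fun ρ hρ => mul_nonneg (by positivity) (ND.ray_nonneg_of_isSmoothCone hσ hρ i))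
  have hBpos : 0 < B.toNat := by omega
  have hcoefv : 0 < B.toNat * c v + A.toNat * (if v = v then (lin (zOf m m') ρ₀).toNat else if v = ρ₀ then (-lin (zOf m m') v).toNat else 0) :=
    Nat.add_pos_left (Nat.mul_pos hBpos hcv') _
  have hy'ne : y' ≠ 0 := by
    obtain ⟨i, hi⟩ := exists_pos_coord (ND.ray_nonneg_of_isSmoothCone hσ hv) (ND.ray_ne_zero_of_isSmoothCone hσ hv)
    intro h0
    have e := congr_fun hrep' i
    rw [h0] at e
    simp only [Finset.sum_apply, Pi.smul_apply, smul_eq_mul, Pi.zero_apply] at e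
    have hle : (↑(B.toNat * c v + A.toNat * (if v = v then (lin (zOf m m') ρ₀).toNat else if v = ρ₀ then (-lin (zOf m m') v).toNat else 0)) : ℤ) * v i
        ≤ ∑ ρ ∈ σ, (↑(B.toNat * c ρ + A.toNat * (if ρ = v then (lin (zOf m m') ρ₀).toNat else if ρ = ρ₀ then (-lin (zOf m m') v).toNat else 0)) : ℤ) * ρ i :=
      Finset.single_le_sum (f := fun ρ => (↑(B.toNat * c ρ + A.toNat * (if ρ = v then (lin (zOf m m') ρ₀).toNat else if ρ = ρ₀ then (-lin (zOf m m') v).toNat else 0)) : ℤ) * ρ i)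
        (fun ρ hρ => mul_nonneg (by positivity) (ND.ray_nonneg_of_isSmoothCone hσ hρ i)) hv
    have hpos : (0 : ℤ) < (↑(B.toNat * c v + A.toNat * (if v = v then (lin (zOf m m') ρ₀).toNat else if v = ρ₀ then (-lin (zOf m m') v).toNat else 0)) : ℤ) * v i :=
      mul_pos (by exact_mod_cast hcoefv) hi
    linarith
  -- the node direction of `y'` is a ray of the position, hence (FAN EXCLUSION) a ray `ρ''` of `σ` with `ℓ ρ'' = 0`
  obtain ⟨w, hw, a', b', ha', hb', hyw⟩ := exists_nodeDir hnode hy'0 hy'ne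
  obtain ⟨σ'', hσ'', ρ'', hρ'', a'', b'', ha'', hb'', hwρ⟩ := hN w hw
  have hcomb : (b' * b'') • ρ'' = (a'' * a') • y' := by
    calc (b' * b'') • ρ'' = b' • (b'' • ρ'') := mul_smul _ _ _
      _ = b' • (a'' • w) := by rw [hwρ]
      _ = a'' • (b' • w) := smul_comm _ _ _
      _ = a'' • (a' • y') := by rw [hyw]
      _ = (a'' * a') • y' := (mul_smul _ _ _).symm
  set c' : Ray 3 → ℕ := fun ρ => B.toNat * c ρ + A.toNat * (if ρ = v then (lin (zOf m m') ρ₀).toNat else if ρ = ρ₀ then (-lin (zOf m m') v).toNat else 0) with hc'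
  have hrep'' : Rep σ (fun ρ => (a'' * a').toNat * c' ρ) ((b' * b'') • ρ'') := by
    unfold Rep
    rw [hcomb, ← hrep', Finset.smul_sum]
    refine Finset.sum_congr rfl (fun ρ _ => ?_)
    rw [smul_smul]; congr 1; push_cast; rw [Int.toNat_of_nonneg (by positivity)]
  have hρ''σ : ρ'' ∈ σ := mem_of_smul_rep hSep hσF hσ'' hρ'' (k := (b' * b'').toNat)
    (by have : 0 < b' * b'' := mul_pos hb' hb''; omega) (c := fun ρ => (a'' * a').toNat * c' ρ)
    (by rw [Int.toNat_of_nonneg (mul_pos hb' hb'').le]; exact hrep'')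
  -- the relation `(b' b'') ρ'' = Σ (a'' a') c' ρ • ρ` is a non-trivial relation among the rays of `σ` unless ... compare coefficients at `v`
  have hrel : ∑ ρ ∈ σ, ((if ρ = ρ'' then b' * b'' else 0) - (a'' * a') * (c' ρ : ℤ)) • ρ = 0 := by
    have h1 : ∑ ρ ∈ σ, ((if ρ = ρ'' then b' * b'' else 0 : ℤ)) • ρ = (b' * b'') • ρ'' := by
      rw [Finset.sum_congr rfl (fun ρ _ => by rw [ite_smul, zero_smul]), Finset.sum_ite_eq', if_pos hρ''σ]
    have h2 : ∑ ρ ∈ σ, ((a'' * a') * (c' ρ : ℤ)) • ρ = (a'' * a') • y' := by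
      unfold Rep at hrep'
      rw [← hrep', Finset.smul_sum]
      exact Finset.sum_congr rfl (fun ρ _ => by rw [smul_smul])
    rw [Finset.sum_congr rfl (fun ρ _ => sub_smul _ _ ρ), Finset.sum_sub_distrib, h1, h2, hcomb, sub_self]
  have hzero := coeff_eq_zero_of_sum_smul_eq_zero hσ hrel
  -- `ℓ ρ'' = 0`, so `ρ'' ≠ v`, and the coefficient at `v` is `-(a'' a') c' v ≠ 0`
  have hlρ : lin (zOf m m') ρ'' = 0 := by
    have := congr_arg (lin (zOf m m')) hcomb
    rw [lin_smul, lin_smul, hly', mul_zero] at this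
    rcases mul_eq_zero.1 this with h | h
    · exact absurd h (mul_pos hb' hb'').ne'
    · exact h
  have hρv : v ≠ ρ'' := by rintro rfl; linarith
  have := hzero v hv
  rw [if_neg hρv, zero_sub, neg_eq_zero] at this
  rcases mul_eq_zero.1 this with h | h
  · exact absurd h (mul_pos ha'' ha').ne'
  · have hz : c' v = 0 := by exact_mod_cast h
    have : 0 < c' v := by simp only [hc', if_true]; exact Nat.add_pos_left (Nat.mul_pos hBpos hcv') _
    omega

/-- **LEMMA A, positive side** (by the swap symmetry): zero coefficient on every ray `u` with `ℓ u > 0`. -/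
theorem coeff_eq_zero_of_wallPoint' {V : Finset (Fin 3 → ℕ)} {F : Finset (Finset (Ray 3))} (hSep : Separated F) (hN : NodesResolved V F)
    {σ : Finset (Ray 3)} (hσF : σ ∈ F) (hσ : ND.IsSmoothCone σ) {m m' : Fin 3 → ℕ} (hm : m ∈ V) (hm' : m' ∈ V) (hmm' : m ≠ m')
    (hno : ∀ u ∈ σ, ∀ v ∈ σ, ¬ WCross V m m' u v) {c : Ray 3 → ℕ} {y : Ray 3} (hy : Rep σ c y) (hly : lin (zOf m m') y = 0)
    (hmin : ∀ m'' ∈ V, pair y m ≤ pair y m'') {u : Ray 3} (hu : u ∈ σ) (hlu : 0 < lin (zOf m m') u) : c u = 0 := by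
  have hl : ∀ ρ, lin (zOf m' m) ρ = -lin (zOf m m') ρ := fun ρ => by rw [lin_zOf, lin_zOf]; ring
  have hno' : ∀ u ∈ σ, ∀ v ∈ σ, ¬ WCross V m' m u v := fun u hu v hv h => hno v hv u hu (wcross_swap h)
  have hmin' : ∀ m'' ∈ V, pair y m' ≤ pair y m'' := fun m'' hm'' => by
    have h0 := hmin m'' hm''; rw [lin_zOf] at hly; linarith
  exact coeff_eq_zero_of_wallPoint hSep hN hσF hσ hm' hm (Ne.symm hmm') hno' hy (by rw [hl, hly, neg_zero]) hmin' hu (by rw [hl]; linarith)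

/-- **LEMMA B.**  Under the invariants, a cone without W-crossing pair keeps this property in its children under any star: the new ray `Σ τ` forms
no W-crossing pair with an old ray. [OURS · L1 W4.5b · brick 2c] -/
theorem not_wcross_sum {V : Finset (Fin 3 → ℕ)} {F : Finset (Finset (Ray 3))} (hSep : Separated F) (hN : NodesResolved V F)
    {σ : Finset (Ray 3)} (hσF : σ ∈ F) (hσ : ND.IsSmoothCone σ) {m m' : Fin 3 → ℕ} (hm : m ∈ V) (hm' : m' ∈ V) (hmm' : m ≠ m')
    (hno : ∀ u ∈ σ, ∀ v ∈ σ, ¬ WCross V m m' u v) {τ : Finset (Ray 3)} (hτσ : τ ⊆ σ) {v : Ray 3} (hv : v ∈ σ) :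
    ¬ WCross V m m' (∑ ρ ∈ τ, ρ) v ∧ ¬ WCross V m m' v (∑ ρ ∈ τ, ρ) := by
  classical
  -- the crossing point of `(s, v)` resp. `(v, s)` is represented over `σ` with positive coefficient on `v`
  have repx : ∀ (a b : ℤ), 0 ≤ a → 0 < b →
      Rep σ (fun ρ => (if ρ ∈ τ then a.toNat else 0) + (if ρ = v then b.toNat else 0)) (a • (∑ ρ ∈ τ, ρ) + b • v) := by
    intro a b ha hb
    unfold Rep
    rw [Finset.sum_congr rfl (fun ρ _ => by rw [Nat.cast_add, add_smul]), Finset.sum_add_distrib]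
    congr 1
    · rw [Finset.smul_sum, ← Finset.sum_subset hτσ (fun ρ _ hρτ => by rw [if_neg hρτ]; simp)]
      exact Finset.sum_congr rfl (fun ρ hρ => by rw [if_pos hρ, Int.toNat_of_nonneg ha])
    · have hterm : ∀ ρ ∈ σ, (((if ρ = v then b.toNat else 0 : ℕ) : ℤ)) • ρ = if ρ = v then b • v else 0 := by
        intro ρ _
        by_cases h : ρ = v
        · subst h; rw [if_pos rfl, if_pos rfl, Int.toNat_of_nonneg hb.le]
        · rw [if_neg h, if_neg h]; simp
      rw [Finset.sum_congr rfl hterm, Finset.sum_ite_eq' σ v, if_pos hv]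
  constructor
  · rintro ⟨hls, hlv, hmin⟩
    have hrep := repx (-lin (zOf m m') v) (lin (zOf m m') (∑ ρ ∈ τ, ρ)) (by linarith) hls
    have hx : (-lin (zOf m m') v) • (∑ ρ ∈ τ, ρ) + (lin (zOf m m') (∑ ρ ∈ τ, ρ)) • v = xPt m m' (∑ ρ ∈ τ, ρ) v := by
      rw [xPt, add_comm]
    rw [hx] at hrep
    have h0 := coeff_eq_zero_of_wallPoint hSep hN hσF hσ hm hm' hmm' hno hrep (lin_xPt _ _ _ _) hmin hv hlv
    simp only [if_true] at h0
    have : 0 < (lin (zOf m m') (∑ ρ ∈ τ, ρ)).toNat := by omega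
    omega
  · rintro ⟨hlv, hls, hmin⟩
    have hrep := repx (lin (zOf m m') v) (-lin (zOf m m') (∑ ρ ∈ τ, ρ)) hlv.le (by linarith)
    have hx : (lin (zOf m m') v) • (∑ ρ ∈ τ, ρ) + (-lin (zOf m m') (∑ ρ ∈ τ, ρ)) • v = xPt m m' v (∑ ρ ∈ τ, ρ) := by
      rw [xPt]
    rw [hx] at hrep
    have h0 := coeff_eq_zero_of_wallPoint' hSep hN hσF hσ hm hm' hmm' hno hrep (lin_xPt _ _ _ _) hmin hv hlv
    simp only [if_true] at h0
    have : 0 < (-lin (zOf m m') (∑ ρ ∈ τ, ρ)).toNat := by omega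
    omega

/-- `NoWCross` survives a star at a face of a cone of the position (under the invariants). -/
theorem noWCross_star {V : Finset (Fin 3 → ℕ)} {F : Finset (Finset (Ray 3))} (hR : Reach V (orthantFan 3) F) (hN : NodesResolved V F)
    {m m' : Fin 3 → ℕ} (hm : m ∈ V) (hm' : m' ∈ V) (hmm' : m ≠ m') (hno : NoWCross V m m' F)
    (τ : Finset (Ray 3)) : NoWCross V m m' (star F τ) := by
  classical
  have hSep := separated_of_reach_orthant V hR
  intro γ hγ u hu v hv hW
  rcases (ND.mem_star_iff F τ γ).1 hγ with ⟨hγF, -⟩ | ⟨σ, hσ, hτσ, t, ht, rfl⟩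
  · exact hno γ hγF u hu v hv hW
  · have hσs := ND.isSmoothCone_of_reach_orthant V hR hσ
    have key := fun (x : Ray 3) (hx : x ∈ σ) => not_wcross_sum hSep hN hσ hσs hm hm' hmm' (hno σ hσ) hτσ hx
    rcases Finset.mem_insert.1 hu with rfl | hu'
    · rcases Finset.mem_insert.1 hv with rfl | hv'
      · exact lt_irrefl _ (hW.2.1.trans hW.1)
      · exact (key v (Finset.mem_of_mem_erase hv')).1 hW
    · rcases Finset.mem_insert.1 hv with rfl | hv'
      · exact (key u (Finset.mem_of_mem_erase hu')).2 hW
      · exact hno σ hσ u (Finset.mem_of_mem_erase hu') v (Finset.mem_of_mem_erase hv') hW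

/-- `NoWCross` survives every E1-legal continuation of a position reachable from the orthant in which node directions are rays. -/
theorem noWCross_of_reach {V : Finset (Fin 3 → ℕ)} (hV : V.Nonempty) {F F' : Finset (Finset (Ray 3))} (h : Reach V F F')
    (hR : Reach V (orthantFan 3) F) (hN : NodesResolved V F) {m m' : Fin 3 → ℕ} (hm : m ∈ V) (hm' : m' ∈ V) (hmm' : m ≠ m')
    (hno : NoWCross V m m' F) : NoWCross V m m' F' := by
  induction h with
  | refl => exact hno
  | step F₂ τ σ hR₂ _ _ _ _ ih =>
    have hR' : Reach V (orthantFan 3) F₂ := reach_trans V hR₂ hR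
    exact noWCross_star hR' (nodesResolved_of_reach hV hR₂ hN) hm hm' hmm' ih τ


end FanGame

end Summit.ResolutionOfSingularities.ResolutionOfSingularities.Cruxes.EquisingularLiftNat.Sections
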